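import Mathlib.Analysis.SpecialFunctions.Exponential
import Mathlib.Analysis.Calculus.Deriv.Prod
import Mathlib.Analysis.Normed.Group.Bounded
import Mathlib.Analysis.Matrix.Normed
import Mathlib.LinearAlgebra.Dual.Lemmas
import Literature.NumberTheory.Automorphic.GKModulesOneParameter
import Literature.NumberTheory.Automorphic.GKModulesAdCompatOfWeakDeriv
import Literature.Analysis.Calculus.TaylorFlatnessDerivFamily
import HarnessLib

/-!
# On a finite-dimensional `K`-stable subspace of a `(𝔤, K)`-module, `ρK (exp Z) = exp (ρ𝔤 Z)` as matrices (`Z ∈ 𝔨`)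

Topic `NumberTheory/Automorphic`; namespace `Literature.NumberTheory.Automorphic.IsGKModule` (companion of ★ `GKModules`, ★ `GKModulesOneParameter`,
★ `GKModulesKActionUnique`); sequel `GKModulesKActionAlongCurves`.  Cell `hodgecm-mathlib`, F0∕P3, ROAD-GLOB to the letter A6 #92
`HasUnitaryGlobalizationOfInfUnitary` at `U(2,1)`, brick **«KD»** (LEAD F0P3b-p01 (g3) WANTED 2026-08-31T20:56:39Z), first file.  Three small definitions
WITH BODIES (`coordFn`, `coords`, `mat`: coordinates in a basis of a finite-dimensional subspace, extended to `V` by Mathlib `Subspace.dualLift`) + theorems;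
no named fact, no instance, no notation, no `sorry`.

THE MATHEMATICS ([KnappVogan1995, §I.4 (1.64)–(1.65)]: in a `(𝔤, K)`-module the action of `K` on each finite-dimensional `K`-stable subspace is
smooth with differential `ρ𝔤|_𝔨`; [Hall2015, Cor. 3.44]).  Let `(ρK, ρ𝔤)` satisfy the `(𝔤, K)`-axioms (★ `IsGKModule`: weak derivative of `ρK` along `𝔨`
is `ρ𝔤`), let `F ≤ V` be finite-dimensional and `K`-stable (hence `𝔨`-stable, ★ `apply_mem_of_K_stable_of_hasWeakDeriv`) with a basis `b`, and let
`mat b T` denote the matrix of an operator `T` preserving `F`.  THEN for `Z ∈ 𝔨` and `u ∈ F`: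
**`coords b (ρK (expK (t • Z)) u) = exp (t • mat b (ρ𝔤 Z)) *ᵥ coords b u`** (`coords_expK_smul`, `|t| < 2`; `t = 1`: `coords_expK`).  Proof WITHOUT
unitarity and without one-parameter-group theory: both sides, as families indexed by `u ∈ F`, are `d/dt`-closed with `D = ρ𝔤 Z` (★ `hasDerivAt_coeff`;
Mathlib `hasDerivAt_exp_smul_const`), have factorial bounds on `|t| < 2` (continuity of the two matrix-valued factors on the compact `[-2, 2]`,
`‖Mⁿ c‖ ≤ ‖M‖ⁿ ‖c‖ ≤ n!·(‖M‖+1)ⁿ‖c‖`) and agree at `t = 0`; ★ `eqOn_of_hasDerivAt_family_of_factorial_bound` (Taylor engine A′).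

HONEST LABEL: helper brick; closes no registered stub.  HC_CM is proved only modulo the 2 remaining named inputs (hLiu418, h413) until rung 0 closes.

## Mathlib ∕ tree search
Mathlib: `Subspace.dualLift_of_mem`, `Module.Basis.sum_repr`, `Matrix.mulVec`, `Matrix.linfty_opNorm_mulVec` (`open scoped Matrix.Norms.Operator`),
`hasDerivAt_exp_smul_const`, `NormedSpace.exp_continuous`, `IsCompact.exists_bound_of_continuousOn`, `hasDerivAt_pi`.  Tree: ★ `IsGKModule.hasDerivAt_coeff`,
★ `RealMatrixGroup.expK_zero_smul`, ★ `IsGKModule.apply_mem_of_K_stable_of_hasWeakDeriv`, ★ `Literature.Analysis.Calculus.eqOn_of_hasDerivAt_family_of_factorial_bound`.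
Dedup: `rg "coords_expK|def coordFn|def mat "` over `Literature/NumberTheory/Automorphic` — no hits (★ `GKModulesKActionUnique` compares two K-actions;
it does not produce the matrix exponential).

## References
* A. W. Knapp, D. A. Vogan, *Cohomological Induction and Unitary Representations* (1995), §I.4 (1.64)–(1.65) [KnappVogan1995].
* B. C. Hall, *Lie Groups, Lie Algebras, and Representations*, 2nd ed., GTM 222 (2015), Cor. 3.44 [Hall2015].
-/

set_option autoImplicit false

noncomputable section

-- Mathlib idiom (as in ★ `GKModules`): the commutator bracket on `Module.End ℂ V` / matrices, to MENTION `ρ𝔤 : 𝔤 →ₗ⁅ℝ⁆ End V`.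
attribute [local instance 100] LieRing.ofAssociativeRing

open Filter Topology Finset Matrix
open scoped Nat Matrix.Norms.Operator ContDiff

namespace Literature.NumberTheory.Automorphic

namespace IsGKModule

variable {A : Type*} [NormedCommRing A] [NormedAlgebra ℝ A] [NormedAlgebra ℚ A] [CompleteSpace A]
  [StarRing A] [StarModule ℝ A] [ContinuousStar A] {N : Type*} [Fintype N] [DecidableEq N]
  {G : RealMatrixGroup A N}
  {V : Type*} [AddCommGroup V] [Module ℂ V]
  {ρK : Representation ℂ G.maximalCompact V} {ρ𝔤 : G.lie →ₗ⁅ℝ⁆ Module.End ℂ V}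

/-! ## §1 Coordinates on a finite-dimensional subspace -/

section Coord

variable {F : Submodule ℂ V} {d : ℕ} (b : Module.Basis (Fin d) ℂ F)

/-- The coordinate functionals of a basis of `F`, extended to `V` (Mathlib `Subspace.dualLift`). [cite: KnappVogan1995, §I.4 (1.64)–(1.65)] -/
def coordFn (i : Fin d) : Module.Dual ℂ V := Subspace.dualLift F (b.coord i)

/-- `coordFn b i w = (b.repr w) i` on `F`. [cite: KnappVogan1995, §I.4 (1.64)–(1.65)] -/
theorem coordFn_apply_of_mem (i : Fin d) {w : V} (hw : w ∈ F) : coordFn b i w = b.repr ⟨w, hw⟩ i := by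
  rw [coordFn, Subspace.dualLift_of_mem hw, Module.Basis.coord_apply]

/-- Basis expansion on `F`: `w = Σ_i coordFn b i w • b i`. [cite: KnappVogan1995, §I.4 (1.64)–(1.65)] -/
theorem sum_coordFn_smul {w : V} (hw : w ∈ F) : ∑ i, coordFn b i w • (b i : V) = w := by
  have h' : ∑ i, (b.repr ⟨w, hw⟩ i) • (b i : V) = w := by
    have h := congrArg (Submodule.subtype F) (b.sum_repr ⟨w, hw⟩)
    simpa only [map_sum, map_smul, Submodule.coe_subtype] using h
  calc ∑ i, coordFn b i w • (b i : V) = ∑ i, (b.repr ⟨w, hw⟩ i) • (b i : V) :=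
        Finset.sum_congr rfl fun i _ => by rw [coordFn_apply_of_mem b i hw]
    _ = w := h'

/-- The coordinate vector of `w`: `coords b w i = coordFn b i w`. [cite: KnappVogan1995, §I.4 (1.64)–(1.65)] -/
def coords (w : V) : Fin d → ℂ := fun i => coordFn b i w

/-- The matrix of an operator `T` on `V` preserving `F`, in the basis `b`: `mat b T i j = coordFn b i (T (b j))`.
[cite: KnappVogan1995, §I.4 (1.64)–(1.65)] -/
def mat (T : V →ₗ[ℂ] V) : Matrix (Fin d) (Fin d) ℂ := Matrix.of fun i j => coordFn b i (T (b j : V))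

/-- **`mat b T *ᵥ coords b w = coords b (T w)`** for `w ∈ F` and `T` linear. [cite: KnappVogan1995, §I.4 (1.64)–(1.65)] -/
theorem mat_mulVec_coords (T : V →ₗ[ℂ] V) {w : V} (hw : w ∈ F) : mat b T *ᵥ coords b w = coords b (T w) := by
  funext i
  rw [Matrix.mulVec, dotProduct]
  conv_rhs => rw [coords, ← sum_coordFn_smul b hw, map_sum, map_sum]
  refine Finset.sum_congr rfl fun j _ => ?_
  rw [mat, Matrix.of_apply, coords, map_smul, map_smul, smul_eq_mul, mul_comm]

/-- Powers: `(mat b T)^n *ᵥ coords b w = coords b ((T^n) w)` for `T` preserving `F`, `w ∈ F`. [cite: KnappVogan1995, §I.4 (1.64)–(1.65)] -/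
theorem mat_pow_mulVec_coords (T : V →ₗ[ℂ] V) (hT : ∀ w ∈ F, T w ∈ F) {w : V} (hw : w ∈ F) (n : ℕ) :
    (mat b T) ^ n *ᵥ coords b w = coords b ((T ^ n) w) := by
  induction n generalizing w with
  | zero => simp
  | succ n ih =>
    rw [pow_succ, ← Matrix.mulVec_mulVec, mat_mulVec_coords b T hw, ih (hT w hw), ← Module.End.mul_apply, ← pow_succ]

/-- Norm bound for powers: `‖(mat b T)^n *ᵥ c‖ ≤ ‖mat b T‖^n ‖c‖` (`L^∞` operator norm). [cite: KnappVogan1995, §I.4 (1.64)–(1.65)] -/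
theorem norm_pow_mulVec_le (M : Matrix (Fin d) (Fin d) ℂ) (c : Fin d → ℂ) (n : ℕ) : ‖M ^ n *ᵥ c‖ ≤ ‖M‖ ^ n * ‖c‖ := by
  induction n with
  | zero => simp
  | succ n ih =>
    rw [pow_succ', ← Matrix.mulVec_mulVec, pow_succ']
    calc ‖M *ᵥ (M ^ n *ᵥ c)‖ ≤ ‖M‖ * ‖M ^ n *ᵥ c‖ := Matrix.linfty_opNorm_mulVec _ _
      _ ≤ ‖M‖ * (‖M‖ ^ n * ‖c‖) := by gcongr
      _ = ‖M‖ * ‖M‖ ^ n * ‖c‖ := by ring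

end Coord

/-! ## §2 `ρK (expK Z) = exp (matrix of ρ𝔤 Z)` on a finite-dimensional `K`-stable subspace -/

section ExpIdentity

variable {F : Submodule ℂ V} {d : ℕ} (b : Module.Basis (Fin d) ℂ F)

/-- **On a finite-dimensional `K`-stable subspace `F`, `K`'s one-parameter groups are matrix exponentials of `𝔨`**:
`coords (ρK (expK (t • Z)) u) = exp (t • mat (ρ𝔤 Z)) *ᵥ coords u` for `u ∈ F` — both sides are `d/dt`-closed families (★ `hasDerivAt_coeff`;
Mathlib `hasDerivAt_exp_smul_const`) with factorial bounds on `|t| < 2`, equal at `t = 0` (★ Taylor engine `eqOn_of_hasDerivAt_family_of_factorial_bound`).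
No unitarity is used. [cite: KnappVogan1995, §I.4 (1.64)–(1.65)] [cite: Hall2015, Cor. 3.44] -/
theorem coords_expK_smul (h : IsGKModule G ρK ρ𝔤) (hF : ∀ (k : G.maximalCompact), ∀ u ∈ F, ρK k u ∈ F) (Z : G.compactLie)
    {u : V} (hu : u ∈ F) {t : ℝ} (ht : t ∈ Set.Ioo (-2 : ℝ) 2) :
    coords b (ρK (G.expK (t • Z)) u) =
      NormedSpace.exp (t • mat b (ρ𝔤 (LieSubalgebra.inclusion G.compactLie_le_lie Z) : V →ₗ[ℂ] V)) *ᵥ coords b u := by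
  set T : V →ₗ[ℂ] V := (ρ𝔤 (LieSubalgebra.inclusion G.compactLie_le_lie Z) : V →ₗ[ℂ] V) with hT
  have hTF : ∀ w ∈ F, T w ∈ F := fun w hw => IsGKModule.apply_mem_of_K_stable_of_hasWeakDeriv h.hasWeakDeriv Z hF hw
  set M := mat b T with hM
  -- families indexed by `w : F`
  let f : F → ℝ → (Fin d → ℂ) := fun w s => coords b (ρK (G.expK (s • Z)) (w : V))
  let g : F → ℝ → (Fin d → ℂ) := fun w s => NormedSpace.exp (s • M) *ᵥ coords b (w : V)
  let D : F → F := fun w => ⟨T w, hTF w w.2⟩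
  have hDpow : ∀ n (w : F), ((D^[n] w : F) : V) = (T ^ n) (w : V) := by
    intro n; induction n with
    | zero => intro w; simp
    | succ n ih => intro w; rw [Function.iterate_succ_apply', pow_succ', Module.End.mul_apply, ← ih]
  -- derivatives
  have hfder : ∀ (w : F) s, HasDerivAt (f w) (f (D w) s) s := by
    intro w s
    refine hasDerivAt_pi.mpr fun i => ?_
    exact IsGKModule.hasDerivAt_coeff h Z (w : V) (coordFn b i) s
  have hgder : ∀ (w : F) s, HasDerivAt (g w) (g (D w) s) s := by
    intro w s
    have h1 := hasDerivAt_exp_smul_const (𝕂 := ℝ) M s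
    -- apply the linear map `P ↦ P *ᵥ c`
    let Lc : Matrix (Fin d) (Fin d) ℂ →ₗ[ℝ] (Fin d → ℂ) :=
      { toFun := fun P => P *ᵥ coords b (w : V)
        map_add' := fun P Q => Matrix.add_mulVec P Q _
        map_smul' := fun c P => by rw [Matrix.smul_mulVec, RingHom.id_apply] }
    let LcL : Matrix (Fin d) (Fin d) ℂ →L[ℝ] (Fin d → ℂ) := ⟨Lc, Lc.continuous_of_finiteDimensional⟩
    have h2 := LcL.hasFDerivAt.comp_hasDerivAt s h1
    have hval : LcL (NormedSpace.exp (s • M) * M) = g (D w) s := by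
      show (NormedSpace.exp (s • M) * M) *ᵥ coords b (w : V) = NormedSpace.exp (s • M) *ᵥ coords b ((D w : F) : V)
      rw [← Matrix.mulVec_mulVec, hM, mat_mulVec_coords b T w.2]
    exact h2.congr_deriv hval
  -- bounds on `J = (-2, 2)`: continuity on the compact `[-2, 2]` of the two operator-valued factors
  have hcontf : ∀ i j : Fin d, Continuous fun s : ℝ => coordFn b i (ρK (G.expK (s • Z)) (b j : V)) := fun i j =>
    continuous_iff_continuousAt.mpr fun s => (IsGKModule.hasDerivAt_coeff h Z (b j : V) (coordFn b i) s).continuousAt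
  -- the matrix of `ρK (expK sZ)` on `F`
  let Kmat : ℝ → Matrix (Fin d) (Fin d) ℂ := fun s => mat b (ρK (G.expK (s • Z)) : V →ₗ[ℂ] V)
  have hKmat : Continuous Kmat := by
    refine continuous_pi fun i => continuous_pi fun j => ?_
    exact hcontf i j
  obtain ⟨S, hS⟩ : ∃ S, ∀ s ∈ Set.Icc (-2 : ℝ) 2, ‖Kmat s‖ ≤ S :=
    (isCompact_Icc (a := (-2 : ℝ)) (b := 2)).exists_bound_of_continuousOn hKmat.continuousOn
  have hEc : Continuous fun s : ℝ => NormedSpace.exp (s • M) :=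
    NormedSpace.exp_continuous.comp (continuous_id.smul continuous_const)
  obtain ⟨S', hS'⟩ : ∃ S', ∀ s ∈ Set.Icc (-2 : ℝ) 2, ‖NormedSpace.exp (s • M)‖ ≤ S' :=
    (isCompact_Icc (a := (-2 : ℝ)) (b := 2)).exists_bound_of_continuousOn hEc.continuousOn
  have hr : 0 < (‖M‖ + 1)⁻¹ := by positivity
  have hJsub : Set.Ioo (-2 : ℝ) 2 ⊆ Set.Icc (-2) 2 := Set.Ioo_subset_Icc_self
  have hfac : ∀ n : ℕ, ‖M‖ ^ n ≤ n ! / ((‖M‖ + 1)⁻¹) ^ n := by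
    intro n
    rw [inv_pow, div_inv_eq_mul]
    calc ‖M‖ ^ n ≤ (‖M‖ + 1) ^ n := pow_le_pow_left₀ (norm_nonneg _) (by linarith) n
      _ = 1 * (‖M‖ + 1) ^ n := (one_mul _).symm
      _ ≤ n ! * (‖M‖ + 1) ^ n := by gcongr; exact_mod_cast Nat.one_le_iff_ne_zero.mpr (Nat.factorial_ne_zero n)
  have hfbd : ∀ w : F, ∃ Mb, ∀ n, ∀ s ∈ Set.Ioo (-2 : ℝ) 2, ‖f (D^[n] w) s‖ ≤ Mb * n ! / ((‖M‖ + 1)⁻¹) ^ n := by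
    intro w
    refine ⟨max S 0 * ‖coords b (w : V)‖, fun n s hs => ?_⟩
    have hKs := hS s (hJsub hs)
    show ‖coords b (ρK (G.expK (s • Z)) ((D^[n] w : F) : V))‖ ≤ _
    rw [hDpow, ← mat_mulVec_coords b _ (by
      clear hKs; induction n with
      | zero => simp
      | succ n ih => rw [pow_succ', Module.End.mul_apply]; exact hTF _ ih), ← mat_pow_mulVec_coords b T hTF w.2 n]
    calc ‖Kmat s *ᵥ (M ^ n *ᵥ coords b (w : V))‖ ≤ ‖Kmat s‖ * ‖M ^ n *ᵥ coords b (w : V)‖ := Matrix.linfty_opNorm_mulVec _ _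
      _ ≤ max S 0 * (‖M‖ ^ n * ‖coords b (w : V)‖) := by
          gcongr
          · exact hKs.trans (le_max_left _ _)
          · exact norm_pow_mulVec_le M _ n
      _ ≤ max S 0 * (n ! / ((‖M‖ + 1)⁻¹) ^ n * ‖coords b (w : V)‖) := by gcongr; exact hfac n
      _ = max S 0 * ‖coords b (w : V)‖ * n ! / ((‖M‖ + 1)⁻¹) ^ n := by ring
  have hgbd : ∀ w : F, ∃ Mb, ∀ n, ∀ s ∈ Set.Ioo (-2 : ℝ) 2, ‖g (D^[n] w) s‖ ≤ Mb * n ! / ((‖M‖ + 1)⁻¹) ^ n := by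
    intro w
    refine ⟨max S' 0 * ‖coords b (w : V)‖, fun n s hs => ?_⟩
    have hEs := hS' s (hJsub hs)
    show ‖NormedSpace.exp (s • M) *ᵥ coords b ((D^[n] w : F) : V)‖ ≤ _
    rw [hDpow, ← mat_pow_mulVec_coords b T hTF w.2 n]
    calc ‖NormedSpace.exp (s • M) *ᵥ (M ^ n *ᵥ coords b (w : V))‖
          ≤ ‖NormedSpace.exp (s • M)‖ * ‖M ^ n *ᵥ coords b (w : V)‖ := Matrix.linfty_opNorm_mulVec _ _
      _ ≤ max S' 0 * (‖M‖ ^ n * ‖coords b (w : V)‖) := by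
          gcongr
          · exact hEs.trans (le_max_left _ _)
          · exact norm_pow_mulVec_le M _ n
      _ ≤ max S' 0 * (n ! / ((‖M‖ + 1)⁻¹) ^ n * ‖coords b (w : V)‖) := by gcongr; exact hfac n
      _ = max S' 0 * ‖coords b (w : V)‖ * n ! / ((‖M‖ + 1)⁻¹) ^ n := by ring
  have h0 : ∀ w : F, f w 0 = g w 0 := fun w => by
    show coords b (ρK (G.expK ((0 : ℝ) • Z)) (w : V)) = NormedSpace.exp ((0 : ℝ) • M) *ᵥ coords b (w : V)
    rw [RealMatrixGroup.expK_zero_smul, map_one, zero_smul, NormedSpace.exp_zero, Matrix.one_mulVec]; rfl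
  have h := Literature.Analysis.Calculus.eqOn_of_hasDerivAt_family_of_factorial_bound isOpen_Ioo isPreconnected_Ioo
    (s₀ := 0) (by norm_num) f g D (fun w s _ => hfder w s) (fun w s _ => hgder w s) hr hfbd hgbd h0 ⟨u, hu⟩ ht
  exact h

/-- The same at `t = 1`: **`coords (ρK (expK Z) u) = exp (mat (ρ𝔤 Z)) *ᵥ coords u`** for `u` in the `K`-stable finite-dimensional `F`.
[cite: KnappVogan1995, §I.4 (1.64)–(1.65)] [cite: Hall2015, Cor. 3.44] -/
theorem coords_expK (h : IsGKModule G ρK ρ𝔤) (hF : ∀ (k : G.maximalCompact), ∀ u ∈ F, ρK k u ∈ F) (Z : G.compactLie)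
    {u : V} (hu : u ∈ F) :
    coords b (ρK (G.expK Z) u) = NormedSpace.exp (mat b (ρ𝔤 (LieSubalgebra.inclusion G.compactLie_le_lie Z) : V →ₗ[ℂ] V)) *ᵥ coords b u := by
  have h1 := coords_expK_smul b h hF Z hu (t := 1) (by norm_num)
  rwa [one_smul, one_smul] at h1

end ExpIdentity

end IsGKModule

end Literature.NumberTheory.Automorphic

end
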